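/-
Copyright (c) 2026 the pub-hodgecm-mathlib formalisation cell (harness21).  Prover seat hodgecm-mathlib-K2E4-p10 (g4), Track B ∕ K2-LIT, h413 =
`stmt-HodgeConjecture-24833`, line `K2_E1_TraceFormulaBeta`, campaign «EIS-RANK-ONE» rung R6h (brick (R6h-b) = (α) JUNCTION of the dealer K2E1-plan (g4)
2026-09-04T06:33:01Z ∕ first refusal 06:36Z): the COMPLEX diagonal Maass–Selberg identity ⟹ the REAL «four terms ≥ 0» inequality of ★ (R6h-a), hence pole control of the
intertwined coefficient — abstract junction + the CM instance on `{Re z > 2}`.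
-/
import Summits.HodgeConjecture.HodgeConjecture.Theorems.K2E1MaassSelbergPoleControl                -- ★ (K2E3-p12 g5): the (a,b,c)-EXTRACTION LETTER `maassSelbergDiag_of_fourTerm`∕`poleControl_of_fourTerm` (imports ★ p857974 (R6h-a))
import Summits.HodgeConjecture.HodgeConjecture.Theorems.K2E1MaassSelbergDiagonalCMThree            -- ★ p857918 (this seat): (R6g-b) the diagonal `∫‖Λ^T E(φ,z)‖² = R z`
import Summits.HodgeConjecture.HodgeConjecture.Theorems.K2E1TruncatedEisensteinContinuousCMThree   -- ★ p857975 (this seat): (R6g-c) `hcont` discharged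
import HarnessLib

/-!
# K2·E1 — `K2E1MaassSelbergPoleControlCMThree`: THE JUNCTION «COMPLEX DIAGONAL IDENTITY ⟹ REAL POLE INEQUALITY» AND ITS CM INSTANCE ON `{Re z > 2}`
# (campaign «EIS-RANK-ONE», rung R6h, brick (R6h-b): ★ (R6g-b)∕(R6g-c) feed ★ (R6h-a); pole control of `b(z) = ‖(M(z)f)~‖²` wherever the diagonal identity holds)

Track B ∕ K2-LIT, crux h413 = `stmt-HodgeConjecture-24833`, route of record `HCCMUnconditional`; cell `hodgecm-mathlib`, squad K2, ENGINE E1.  Prover seat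
`hodgecm-mathlib-K2E4-p10` (g4); DEAL (α) of the dealer K2E1-plan (g4) 2026-09-04T06:33:01Z (first refusal exercised 06:36Z), SPEC «EIS-R6h POLE INEQUALITY» v1 §2 (R6h-b),
REPORT-FIRST 06:36Z.  THEOREMS ONLY (no `def`, no `instance`, no notation, no named-fact hypothesis, no `sorry`); lane `--supports stmt-HodgeConjecture-24833 --as helper`
(count-neutral).  Closes no socket.

THE MATHEMATICS [MoeglinWaldspurger1995, IV.2.3 and IV.3.12 (a)(b); Garrett2018, §1.12 and §11.3; Arthur1980TraceFormulaII, §4].  At the diagonal `z′ = z` the four exponents of the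
Maass–Selberg relation are `±s₁ = ±(z + conj z − 2) = ±2x` (`x = Re z − 1`, REAL) and `±s₂ = ±(z − conj z) = ±2iy` (`y = Im z`, IMAGINARY), and the four brackets are
`[Ξ₁] = a = ‖φ‖² > 0`, `[Ξ₄] = b = ‖φ̃‖² ≥ 0`, `[Ξ₂] = W`, `[Ξ₃] = conj W` with `|W|² ≤ ab` (Cauchy–Schwarz).  The (a, b, c)-EXTRACTION LETTER ★
`K2E1MaassSelbergPoleControl` (K2E3-p12 (g5), both ranks, `s₁ = 2x` and `s₂ = (2y)i` abstract) turns the COMPLEX identity `↑Q = c₁·(c₂·(four terms))` into ★ (R6h-a)'s REAL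
inequality; this file is its `z`-FORM and its CM INSTANCE: §1 the diagonal bookkeeping `z + conj z − 2 = 2(Re z − 1)` (`U(2,1)`), `z + conj z − 1 = 2(Re z − ½)` (`U(1,1)`) — with
Mathlib's `z − conj z = (2·Im z)i` these instantiate the letter; §2 the junction with `s₂ := z − conj z` LITERAL (as the relation of record ★ p857832∕p857918 prints it) and the
real exponent `s = 2x` a parameter (rank-one generic, imported by the `_two` junction): `maassSelbergDiag_of_fourTerm_conj` (the real pair incl. `|c| ≤ √(ab)∕|y|`),
`poleControl_of_fourTerm_conj` ((a1)(a2)(a3): `√b ≤ x·T^{2x}·√a∕|y| + √(x²T^{4x}a∕y² + aT^{4x})`, the box form, the `1∕y²` form) and `limit_le_of_fourTerm_conj` ((a4) `b₀ ≤ a`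
from a family along `x ↓ 0` at fixed `y ≠ 0`, ★ `limit_le_of_maassSelbergDiag`).  §3 THE CM INSTANCE on `S = {Re z > 2}` for flat sections of `U(J₃)` over the CM
pair: ★ (R6g-b) `maassSelberg_diagonal_flatSectionU_cm_three` with its `hcont` DISCHARGED by ★ (R6g-c) `continuousWithinAt_truncation_eisensteinSeriesU_flatSectionU_subtube_cm_three`
(so it needs only `ν𝓕 < ∞`, the z′-uniform decay `hdec` near `z`, the relation of record `hrel` on the sub-tube and the continuity of its right side `R` at `z`) + the diagonal shape
`hRz` of `R z` ⟹ the pole inequalities for `b`.  On `{Re z > 2}` this is vacuous-but-honest pole control (no poles there); the file is the typed junction that the R7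
continuation will feed with a larger `S`.  NAMED (honest): the Cauchy–Schwarz bound `‖W‖² ≤ a·b` of the cross bracket (idele∕`K_U` Cauchy–Schwarz; (R6h-c) territory).
HONEST LABEL: HC_CM is proved only modulo the 7 printed citations (2 remaining named inputs: hLiu418 = `stmt-HodgeConjecture-24832`, h413 = `stmt-HodgeConjecture-24833`) until rung 0
closes; this file asserts no named fact and closes no socket.
References: [MoeglinWaldspurger1995] IV.2.3, IV.3.12 · [Garrett2018] §1.12, §11.3 · [Arthur1980TraceFormulaII] §4.
-/

set_option autoImplicit false
-- the mandated namespace repeats the single-problem summit's segment (`HodgeConjecture.HodgeConjecture`)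
set_option linter.dupNamespace false

noncomputable section

open MeasureTheory Measure NumberField IsDedekindDomain Set Filter Topology MulAction
open scoped ENNReal NNReal ComplexConjugate
open Literature.NumberTheory.Automorphic Literature.NumberTheory.Automorphic.UnitaryGroup AdelicGroupData
open Summit.HodgeConjecture.HodgeConjecture.Cruxes.H413.K2E1BorelEisensteinU
open Summit.HodgeConjecture.HodgeConjecture.Cruxes.H413.K2E1MaassSelbergPoleInequality
open Summit.HodgeConjecture.HodgeConjecture.Cruxes.H413.K2E1MaassSelbergDiagonalCMThree
open Summit.HodgeConjecture.HodgeConjecture.Cruxes.H413.K2E1TruncatedEisensteinContinuousCMThree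

namespace Summit.HodgeConjecture.HodgeConjecture.Cruxes.H413.K2E1MaassSelbergPoleControlCMThree

/-! ## §1 The diagonal bookkeeping in `z`-form (the extraction letter ★ `K2E1MaassSelbergPoleControl` takes `s₁ = 2x`, `s₂ = (2y)i` abstractly) -/

section Bookkeeping

/-- `s₁` at the diagonal, `U(2,1)` (`2ρ_H = 2`): `z + conj z − 2 = 2(Re z − 1)`. [folklore] -/
theorem add_conj_sub_two_eq (z : ℂ) : z + conj z - 2 = (((2 * (z.re - 1) : ℝ)) : ℂ) := by
  rw [Complex.add_conj]; push_cast; ring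

/-- `s₁` at the diagonal, `U(1,1)` (`2ρ_H = 1`): `z + conj z − 1 = 2(Re z − 1∕2)`. [folklore] -/
theorem add_conj_sub_one_eq (z : ℂ) : z + conj z - 1 = (((2 * (z.re - 1 / 2) : ℝ)) : ℂ) := by
  rw [Complex.add_conj]; push_cast; ring

end Bookkeeping

/-! ## §2 The junction in `z`-form: `s₂ = z − conj z` literal, `s₁ = s = 2x` a parameter (rank-one generic), via the extraction letter ★ `K2E1MaassSelbergPoleControl` -/

section Junction

/-- **THE JUNCTION IN `z`-FORM** (★ `K2E1MaassSelbergPoleControl.maassSelbergDiag_of_fourTerm` at `s₂ := z − conj z = (2·Im z)i`, plus the Cauchy–Schwarz bound of the oscillatory term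
★ `abs_im_mul_div_le`): a non-negative real `Q` (the squared norm `∫_X ‖Λ^T E(φ,z)‖²`) satisfying the COMPLEX diagonal identity with real exponent `s = 2x`, brackets `B₁ = a`, `W`,
`B₃ = conj W`, `B₄ = b`, `c₁, c₂ > 0`, `T ≥ 1`, `Im z ≠ 0`, `‖W‖² ≤ ab` gives ★ (R6h-a)'s REAL hypothesis pair `0 ≤ a·T^{2x}∕(2x) − b·T^{−2x}∕(2x) + c`, `|c| ≤ √(ab)∕|Im z|`,
`c = Im(W·T^{2i·Im z})∕Im z`. [cite: MoeglinWaldspurger1995, IV.3.12 (a)] [cite: Garrett2018, §1.12] -/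
theorem maassSelbergDiag_of_fourTerm_conj {Q a b c₁ c₂ T x : ℝ} (hQ : 0 ≤ Q) (hc₁ : 0 < c₁) (hc₂ : 0 < c₂) (hT : 1 ≤ T) {z s W B₁ B₃ B₄ : ℂ} (hy : z.im ≠ 0)
    (hs : s = ((2 * x : ℝ) : ℂ)) (hB₁ : B₁ = (a : ℂ)) (hB₃ : B₃ = conj W) (hB₄ : B₄ = (b : ℂ)) (hW : ‖W‖ ^ 2 ≤ a * b)
    (h : (Q : ℂ) = (c₁ : ℂ) * ((c₂ : ℂ) *
      ((T : ℂ) ^ s / s * B₁ + (T : ℂ) ^ (z - conj z) / (z - conj z) * W - (T : ℂ) ^ (-(z - conj z)) / (z - conj z) * B₃ - (T : ℂ) ^ (-s) / s * B₄))) :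
    0 ≤ a * T ^ (2 * x) / (2 * x) - b * T ^ (-(2 * x)) / (2 * x) + (W * (T : ℂ) ^ (((2 * z.im : ℝ) : ℂ) * Complex.I)).im / z.im ∧
      |(W * (T : ℂ) ^ (((2 * z.im : ℝ) : ℂ) * Complex.I)).im / z.im| ≤ Real.sqrt (a * b) / |z.im| :=
  have hT0 : 0 < T := lt_of_lt_of_le one_pos hT
  ⟨K2E1MaassSelbergPoleControl.maassSelbergDiag_of_fourTerm hc₁ hc₂ hT0 hy hQ hs (Complex.sub_conj z) hB₁ hB₃ hB₄ h,
    abs_im_mul_div_le (norm_ofReal_cpow_mul_I hT0 (2 * z.im)).le hW z.im⟩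

/-- **POLE CONTROL IN `z`-FORM — (a1)(a2)(a3)** (★ `K2E1MaassSelbergPoleControl.poleControl_of_fourTerm` at `s₂ := z − conj z`): `x > 0`, `Im z ≠ 0`, `a > 0`, `b ≥ 0`, `T ≥ 1`:
`√b ≤ x·T^{2x}·√a∕|y| + √(x²·T^{4x}·a∕y² + a·T^{4x})`, the uniform box form, and the `1∕y²` vertical form, `y = Im z`. [cite: MoeglinWaldspurger1995, IV.3.12 (a)] [cite: Garrett2018, §1.12] -/
theorem poleControl_of_fourTerm_conj {Q a b c₁ c₂ T x : ℝ} (hQ : 0 ≤ Q) (hc₁ : 0 < c₁) (hc₂ : 0 < c₂) (hT : 1 ≤ T) (hx : 0 < x) (ha : 0 < a) (hb : 0 ≤ b) {z s W B₁ B₃ B₄ : ℂ}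
    (hy : z.im ≠ 0) (hs : s = ((2 * x : ℝ) : ℂ)) (hB₁ : B₁ = (a : ℂ)) (hB₃ : B₃ = conj W) (hB₄ : B₄ = (b : ℂ)) (hW : ‖W‖ ^ 2 ≤ a * b)
    (h : (Q : ℂ) = (c₁ : ℂ) * ((c₂ : ℂ) *
      ((T : ℂ) ^ s / s * B₁ + (T : ℂ) ^ (z - conj z) / (z - conj z) * W - (T : ℂ) ^ (-(z - conj z)) / (z - conj z) * B₃ - (T : ℂ) ^ (-s) / s * B₄))) :
    Real.sqrt b ≤ x * T ^ (2 * x) * Real.sqrt a / |z.im| + Real.sqrt (x ^ 2 * T ^ (4 * x) * a / z.im ^ 2 + a * T ^ (4 * x)) ∧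
      (∀ {x₁ x₂ η : ℝ}, 0 < x₁ → x ∈ Set.Icc x₁ x₂ → 0 < η → η ≤ |z.im| →
        b ≤ (x₂ * T ^ (2 * x₂) * Real.sqrt a / η + Real.sqrt (x₂ ^ 2 * T ^ (4 * x₂) * a / η ^ 2 + a * T ^ (4 * x₂))) ^ 2) ∧
      (|z.im| ≤ 1 → b ≤ (x * T ^ (2 * x) * Real.sqrt a + Real.sqrt (x ^ 2 * T ^ (4 * x) * a + a * T ^ (4 * x))) ^ 2 / z.im ^ 2) :=
  K2E1MaassSelbergPoleControl.poleControl_of_fourTerm hc₁ hc₂ hT hx hy hQ ha hb hW hs (Complex.sub_conj z) hB₁ hB₃ hB₄ h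

/-- **(a4) «`‖M‖ ≤ 1` ON THE UNITARY AXIS» IN `z`-FORM** from a FAMILY of complex diagonal identities along the horizontal segment `x ∈ (0, x₂]` at fixed height `Im (z x) = y ≠ 0`, with
brackets `a` (fixed), `W x`, `conj (W x)`, `b x` and `b x → b₀` as `x → 0⁺`: `b₀ ≤ a` (§2 per `x` + ★ (R6h-a) `limit_le_of_maassSelbergDiag`).  The set where the identities hold is the
consumer's (after R7); typed hypothesis-first. [cite: MoeglinWaldspurger1995, IV.3.12 (b)] -/
theorem limit_le_of_fourTerm_conj {a T y x₂ b₀ c₁ c₂ : ℝ} {Q b : ℝ → ℝ} {z s W B₁ B₃ B₄ : ℝ → ℂ} (hT : 1 ≤ T) (hy : y ≠ 0) (hx₂ : 0 < x₂) (hc₁ : 0 < c₁) (hc₂ : 0 < c₂)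
    (hQ : ∀ x ∈ Set.Ioc 0 x₂, 0 ≤ Q x) (hz : ∀ x ∈ Set.Ioc 0 x₂, (z x).im = y) (hs : ∀ x ∈ Set.Ioc 0 x₂, s x = ((2 * x : ℝ) : ℂ))
    (hB₁ : ∀ x ∈ Set.Ioc 0 x₂, B₁ x = (a : ℂ)) (hB₃ : ∀ x ∈ Set.Ioc 0 x₂, B₃ x = conj (W x)) (hB₄ : ∀ x ∈ Set.Ioc 0 x₂, B₄ x = (b x : ℂ))
    (hW : ∀ x ∈ Set.Ioc 0 x₂, ‖W x‖ ^ 2 ≤ a * b x)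
    (h : ∀ x ∈ Set.Ioc 0 x₂, (Q x : ℂ) = (c₁ : ℂ) * ((c₂ : ℂ) *
      ((T : ℂ) ^ s x / s x * B₁ x + (T : ℂ) ^ (z x - conj (z x)) / (z x - conj (z x)) * W x
        - (T : ℂ) ^ (-(z x - conj (z x))) / (z x - conj (z x)) * B₃ x - (T : ℂ) ^ (-s x) / s x * B₄ x)))
    (hb₀ : Tendsto b (𝓝[>] 0) (𝓝 b₀)) : b₀ ≤ a := by
  refine limit_le_of_maassSelbergDiag (c := fun x => (W x * (T : ℂ) ^ (((2 * y : ℝ) : ℂ) * Complex.I)).im / y) hT hy hx₂ (fun x hx => ?_) (fun x hx => ?_) hb₀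
  · have hyx : (z x).im ≠ 0 := by rw [hz x hx]; exact hy
    have key := (maassSelbergDiag_of_fourTerm_conj (hQ x hx) hc₁ hc₂ hT hyx (hs x hx) (hB₁ x hx) (hB₃ x hx) (hB₄ x hx) (hW x hx) (h x hx)).2
    rw [hz x hx] at key
    exact key
  · have hyx : (z x).im ≠ 0 := by rw [hz x hx]; exact hy
    have key := (maassSelbergDiag_of_fourTerm_conj (hQ x hx) hc₁ hc₂ hT hyx (hs x hx) (hB₁ x hx) (hB₃ x hx) (hB₄ x hx) (hW x hx) (h x hx)).1
    rw [hz x hx] at key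
    exact key

end Junction

/-! ## §3 The CM instance on `S = {Re z > 2}`: ★ (R6g-b) with `hcont` discharged by ★ (R6g-c), fed into §2 -/

section CM

variable (L : Type) [Field L] [NumberField L] [IsCMField L]
variable [MeasurableSpace (quasiSplit (↥(maximalRealSubfield L)) L (IsCMField.complexConj L) 3).Adelic]
  [BorelSpace (quasiSplit (↥(maximalRealSubfield L)) L (IsCMField.complexConj L) 3).Adelic]
  [MeasurableSpace (adelicUnipotent (↥(maximalRealSubfield L)) L (IsCMField.complexConj L) 3)]
  [BorelSpace (adelicUnipotent (↥(maximalRealSubfield L)) L (IsCMField.complexConj L) 3)]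

/-- **THE DIAGONAL NORM FORMULA WITH `hcont` DISCHARGED** (★ (R6g-b) `maassSelberg_diagonal_flatSectionU_cm_three` + ★ (R6g-c)): for `Re z > 2`, `T ≥ 1`, `φ` continuous bounded
left-`B(L⁺)`-invariant, `ν` Haar with `ν𝓕 < ∞`, `𝓕` a fundamental domain of `N(L⁺)`, a finite `μ`: the z′-uniform decay `hdec` near `z`, the relation of record `hrel` on the sub-tube
`{2 < Re z′ < Re z}` and the continuity of its right side `R` at `z` give `↑(∫_X ‖quotFun (Λ^T E(φ,z))‖² dμ) = R z`. [cite: Arthur1980TraceFormulaII, §4] [cite: MoeglinWaldspurger1995, IV.2.3] -/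
theorem integral_normSq_truncation_eq_cm_three
    (ν : Measure (adelicUnipotent (↥(maximalRealSubfield L)) L (IsCMField.complexConj L) 3)) [ν.IsHaarMeasure]
    {𝓕 : Set (adelicUnipotent (↥(maximalRealSubfield L)) L (IsCMField.complexConj L) 3)}
    (h𝓕 : IsFundamentalDomain (rationalUnipotent (↥(maximalRealSubfield L)) L (IsCMField.complexConj L) 3) 𝓕 ν) (h𝓕top : ν 𝓕 ≠ ∞) {T : ℝ≥0} (hT : 1 ≤ T)
    {z : ℂ} (hz : 2 < z.re)
    {φ : (quasiSplit (↥(maximalRealSubfield L)) L (IsCMField.complexConj L) 3).Adelic → ℂ} (hφc : Continuous φ) {M : ℝ} (hφM : ∀ x, ‖φ x‖ ≤ M)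
    (hφB : ∀ b ∈ borelU ((IsCMField.complexConj L : L ≃ₐ[↥(maximalRealSubfield L)] L) : L →+* L) ((StdForm.antidiagonal 3).over L),
      ∀ x : (quasiSplit (↥(maximalRealSubfield L)) L (IsCMField.complexConj L) 3).Adelic,
        φ ((quasiSplit (↥(maximalRealSubfield L)) L (IsCMField.complexConj L) 3).toAdelic b * x) = φ x)
    (μ : Measure (quasiSplit (↥(maximalRealSubfield L)) L (IsCMField.complexConj L) 3).automorphicQuotient) [IsFiniteMeasure μ]
    {V : Set ℂ} (hV : V ∈ 𝓝 z) {M₁ : ℝ}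
    (hdec : ∀ z' ∈ V, ∀ g : (quasiSplit (↥(maximalRealSubfield L)) L (IsCMField.complexConj L) 3).Adelic, T < borelHeight g →
      ‖eisensteinSeriesU (flatSectionU φ z') g - borelConstantTerm ν 𝓕 (eisensteinSeriesU (flatSectionU φ z')) g‖ ≤ M₁)
    {R : ℂ → ℂ} (hR : ContinuousWithinAt R {z' : ℂ | 2 < z'.re ∧ z'.re < z.re} z)
    (hrel : ∀ z' : ℂ, 2 < z'.re → z'.re < z.re →
      ∫ x, (quasiSplit (↥(maximalRealSubfield L)) L (IsCMField.complexConj L) 3).quotFun (truncation ν 𝓕 T (eisensteinSeriesU (flatSectionU φ z))) x *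
          conj ((quasiSplit (↥(maximalRealSubfield L)) L (IsCMField.complexConj L) 3).quotFun (truncation ν 𝓕 T (eisensteinSeriesU (flatSectionU φ z'))) x) ∂μ = R z') :
    ((∫ x, ‖(quasiSplit (↥(maximalRealSubfield L)) L (IsCMField.complexConj L) 3).quotFun (truncation ν 𝓕 T (eisensteinSeriesU (flatSectionU φ z))) x‖ ^ 2 ∂μ : ℝ) : ℂ) = R z :=
  maassSelberg_diagonal_flatSectionU_cm_three L ν h𝓕 hT hz hφc hφM hφB μ hV hdec
    (fun g => continuousWithinAt_truncation_eisensteinSeriesU_flatSectionU_subtube_cm_three L ν h𝓕top hT hφc hφM hφB hz g) hR hrel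

/-- **POLE CONTROL AT THE CM PAIR ON `S = {Re z > 2}`** (the convergent-range shadow «`b` bounded off the real axis ∕ `≤ C∕y²`» that R7 will extend): if, in addition, the right
side at the diagonal has the four-term shape `R z = c_μ·(K·(…))` with brackets `B₁ = a > 0` (the `‖φ‖²`-bracket), `W` (the cross bracket), `B₃ = conj W`, `B₄ = b ≥ 0`, `‖W‖² ≤ ab`,
and `Im z ≠ 0`, then with `x = Re z − 1`, `y = Im z`: `√b ≤ x·T^{2x}·√a∕|y| + √(x²T^{4x}a∕y² + aT^{4x})`, the uniform box form, and the `1∕y²` vertical form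
(§3 norm formula + §2 junction + ★ (R6h-a)). [cite: MoeglinWaldspurger1995, IV.3.12 (a)] [cite: Garrett2018, §1.12] [cite: Arthur1980TraceFormulaII, §4] -/
theorem poleControl_diag_flatSectionU_cm_three
    (ν : Measure (adelicUnipotent (↥(maximalRealSubfield L)) L (IsCMField.complexConj L) 3)) [ν.IsHaarMeasure]
    {𝓕 : Set (adelicUnipotent (↥(maximalRealSubfield L)) L (IsCMField.complexConj L) 3)}
    (h𝓕 : IsFundamentalDomain (rationalUnipotent (↥(maximalRealSubfield L)) L (IsCMField.complexConj L) 3) 𝓕 ν) (h𝓕top : ν 𝓕 ≠ ∞) {T : ℝ≥0} (hT : 1 ≤ T)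
    {z : ℂ} (hz : 2 < z.re) (hy : z.im ≠ 0)
    {φ : (quasiSplit (↥(maximalRealSubfield L)) L (IsCMField.complexConj L) 3).Adelic → ℂ} (hφc : Continuous φ) {M : ℝ} (hφM : ∀ x, ‖φ x‖ ≤ M)
    (hφB : ∀ b ∈ borelU ((IsCMField.complexConj L : L ≃ₐ[↥(maximalRealSubfield L)] L) : L →+* L) ((StdForm.antidiagonal 3).over L),
      ∀ x : (quasiSplit (↥(maximalRealSubfield L)) L (IsCMField.complexConj L) 3).Adelic,
        φ ((quasiSplit (↥(maximalRealSubfield L)) L (IsCMField.complexConj L) 3).toAdelic b * x) = φ x)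
    (μ : Measure (quasiSplit (↥(maximalRealSubfield L)) L (IsCMField.complexConj L) 3).automorphicQuotient) [IsFiniteMeasure μ]
    {V : Set ℂ} (hV : V ∈ 𝓝 z) {M₁ : ℝ}
    (hdec : ∀ z' ∈ V, ∀ g : (quasiSplit (↥(maximalRealSubfield L)) L (IsCMField.complexConj L) 3).Adelic, T < borelHeight g →
      ‖eisensteinSeriesU (flatSectionU φ z') g - borelConstantTerm ν 𝓕 (eisensteinSeriesU (flatSectionU φ z')) g‖ ≤ M₁)
    {R : ℂ → ℂ} (hR : ContinuousWithinAt R {z' : ℂ | 2 < z'.re ∧ z'.re < z.re} z)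
    (hrel : ∀ z' : ℂ, 2 < z'.re → z'.re < z.re →
      ∫ x, (quasiSplit (↥(maximalRealSubfield L)) L (IsCMField.complexConj L) 3).quotFun (truncation ν 𝓕 T (eisensteinSeriesU (flatSectionU φ z))) x *
          conj ((quasiSplit (↥(maximalRealSubfield L)) L (IsCMField.complexConj L) 3).quotFun (truncation ν 𝓕 T (eisensteinSeriesU (flatSectionU φ z'))) x) ∂μ = R z')
    -- the diagonal SHAPE of the right side (★ ED. 5∕6 currency) and the bracket facts
    {cμ K a b : ℝ} (hcμ : 0 < cμ) (hK : 0 < K) (ha : 0 < a) (hb : 0 ≤ b) {W B₁ B₃ B₄ : ℂ}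
    (hB₁ : B₁ = (a : ℂ)) (hB₃ : B₃ = conj W) (hB₄ : B₄ = (b : ℂ)) (hW : ‖W‖ ^ 2 ≤ a * b)
    (hRz : R z = (cμ : ℂ) * ((K : ℂ) *
      (((T : ℝ) : ℂ) ^ (z + conj z - 2) / (z + conj z - 2) * B₁ + ((T : ℝ) : ℂ) ^ (z - conj z) / (z - conj z) * W
        - ((T : ℝ) : ℂ) ^ (-(z - conj z)) / (z - conj z) * B₃ - ((T : ℝ) : ℂ) ^ (-(z + conj z - 2)) / (z + conj z - 2) * B₄))) :
    Real.sqrt b ≤ (z.re - 1) * (T : ℝ) ^ (2 * (z.re - 1)) * Real.sqrt a / |z.im| +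
        Real.sqrt ((z.re - 1) ^ 2 * (T : ℝ) ^ (4 * (z.re - 1)) * a / z.im ^ 2 + a * (T : ℝ) ^ (4 * (z.re - 1))) ∧
      (∀ {x₁ x₂ η : ℝ}, 0 < x₁ → z.re - 1 ∈ Set.Icc x₁ x₂ → 0 < η → η ≤ |z.im| →
        b ≤ (x₂ * (T : ℝ) ^ (2 * x₂) * Real.sqrt a / η + Real.sqrt (x₂ ^ 2 * (T : ℝ) ^ (4 * x₂) * a / η ^ 2 + a * (T : ℝ) ^ (4 * x₂))) ^ 2) ∧
      (|z.im| ≤ 1 → b ≤ ((z.re - 1) * (T : ℝ) ^ (2 * (z.re - 1)) * Real.sqrt a +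
        Real.sqrt ((z.re - 1) ^ 2 * (T : ℝ) ^ (4 * (z.re - 1)) * a + a * (T : ℝ) ^ (4 * (z.re - 1)))) ^ 2 / z.im ^ 2) := by
  have hNeq := integral_normSq_truncation_eq_cm_three L ν h𝓕 h𝓕top hT hz hφc hφM hφB μ hV hdec hR hrel
  rw [hRz] at hNeq
  exact poleControl_of_fourTerm_conj (integral_nonneg fun x => sq_nonneg _) hcμ hK (by exact_mod_cast hT) (by linarith) ha hb hy (add_conj_sub_two_eq z) hB₁ hB₃ hB₄ hW hNeq

end CM

end Summit.HodgeConjecture.HodgeConjecture.Cruxes.H413.K2E1MaassSelbergPoleControlCMThree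

end
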